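import Summits.BirchSwinnertonDyer.BirchSwinnertonDyer.Theorems.PrintCf2SplitBadTwoReductionKernelAtPlace
import Summits.BirchSwinnertonDyer.Rank1Residual.Additive.RamifiedOrdinaryLineTransport
import Literature.NumberTheory.EllipticCurves.QuadraticTwistPadicReduction
import HarnessLib

/-!
# Crux `PrintCf2.SplitBadTwoRankOneOfFacts` (stmt-BirchSwinnertonDyer-20368), road α v11.1, S3b′ brick (FIN) via (ET), piece (B1) file 2:
# the twisting isomorphism ON LOCAL POINTS `E₀(K̄_E) ≃ E(K̄_E)` with its sign rule, and the transported kernel of reduction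

Cell `bsd-print-cf2`, EXTRA WIDTH seat `bsd-line-cf2-p1-w8` g3 (prover-bsd-line-cf2-p1-w8-g3-0); `--supports stmt-BirchSwinnertonDyer-20368`
(helper, Theses-free). HONEST FRAMING: nothing here closes the crux or a registered stub; BSD is not proved by any of this; no summit
statement is proved by this seat. No definition, no named fact, no `sorry`, no kit. beyond-print theorem: no.

WHAT (TURNKEY-20368-ET-w3g10 §2 (B1) «transport (i): the quadratic twist on ALL geometric points with the sign-twisted Galois action»):
* `baseChange_baseChange_algebraicClosure` — `(V ⊗ E) ⊗ K̄_E = V ⊗ K̄_E`; the identity-on-coordinates identification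
  `geomPoints (V ⊗ E) ≃+ localPoints V E` along it is `Γ_E`-equivariant (inside the proof of the next theorem).
* **`exists_addEquiv_localPoints_of_model_twist_sign`** — for ANY field `K`, `K`-field `E` with `2 ≠ 0`, curves `V₀, W₁ / K` with
  `C • V₀^{(d)} = W₁`: an additive isomorphism `g : E₀(K̄_E) ≃+ E₁(K̄_E)` of LOCAL points which is `σ`-equivariant for `σ ∈ Γ_E` fixing `√d`
  and anti-equivariant for `σ` negating `√d` — the local twin of -w5/Additive `exists_addEquiv_geomPoints_of_model_twist_sign` (that lemma over the
  base field `E`, transported along `(V ⊗ E) ⊗ K̄_E = V ⊗ K̄_E`).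
* **`exists_twistedKernel`** — pure transport: a `Γ_E`-stable subgroup `𝒦 ≤ E₀(K̄_E)` containing `σP − P` for all `σ` in a set `S ⊆ Γ_E` gives a
  `Γ_E`-stable `𝒦′ = g(𝒦) ≤ E₁(K̄_E)` containing `σP − P` for all `σ ∈ S` FIXING `√d`, and `g` carries non-members to non-members.
* **`exists_twistedReductionKernel_of_frame`** — on the S3c/S3b′ frames (`C • W = cm7^{(d)}` over `ℚ`, any number field `K`, place `w ∤ 7`):
  a `Γ_{K_w}`-stable subgroup `𝒦′ ≤ W_K(K̄_w)` such that `σP − P ∈ 𝒦′` for every `σ` in the INERTIA group fixing `√d` and every `P`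
  (Greenberg's Kummer compatibility for the twist at the primes above `2`, from file 1 `exists_reductionKernel_cm7`), together with a `2`-torsion point
  `T ≠ 0` of `W_K(K̄_w)` OUTSIDE `𝒦′` (the image of `(2, −1) ∈ cm7(ℚ)`, integral abscissa).
NEXT for the (ET) assembly (successor or this seat): `𝒦′ ∩ E[2^∞] = W*′` at `v` (`⊇` from the frame's local types — an inertia element acting on
`W*′` by a unit `≠ 1` — and `⊆` from `T ∉ 𝒦′`), then (B2) and -w2 g12's index-two lemma.
presearch: Silverman AEC X.2 Prop. 2.4, X.5 Cor. 5.4 (twist isomorphism and its cocycle); Greenberg LNM 1716 §2 — tree theorems; no new fact.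

References: [SilvermanAEC2009] X.2 Prop. 2.4, X.5 Cor. 5.4, VII.2.1; [GreenbergLNM1716] §2 pp. 70–75.
-/

noncomputable section

open scoped Classical NNReal

set_option linter.dupNamespace false
set_option autoImplicit false

open NumberField IsDedekindDomain Field WeierstrassCurve
open Literature.NumberTheory.EllipticCurves Literature.NumberTheory.GaloisRepresentations
open IsDedekindDomain.HeightOneSpectrum
open Summit.BirchSwinnertonDyer.Rank1Residual.Additive

namespace Summit.BirchSwinnertonDyer.BirchSwinnertonDyer.Theorems.PrintCf2.ReductionKernel

universe u

/-! ## §1. `geomPoints (V ⊗ E) ≃+ localPoints V E`, equivariantly -/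

section Congr

variable {K : Type u} [Field K] (V : WeierstrassCurve K) (E : Type u) [Field E] [Algebra K E]

/-- `(V ⊗ E) ⊗ K̄_E = V ⊗ K̄_E` (tower of base changes). [folklore] -/
theorem baseChange_baseChange_algebraicClosure :
    (V.baseChange E).baseChange (AlgebraicClosure E) = V.baseChange (AlgebraicClosure E) := by
  rw [WeierstrassCurve.baseChange, WeierstrassCurve.baseChange, WeierstrassCurve.baseChange, WeierstrassCurve.map_map,
    ← IsScalarTower.algebraMap_eq]

/-- Transport along an equality of base-changed equations commutes with the coordinatewise action of a ring endomorphism (both are the identity,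
resp. `ψ`, on coordinates). [folklore] -/
theorem congrEquiv_map_comm {F₀ F₁ L : Type u} [Field F₀] [Field F₁] [Field L] [Algebra F₀ L] [Algebra F₁ L]
    {X : WeierstrassCurve F₀} {Y : WeierstrassCurve F₁}
    (h : X.baseChange L = Y.baseChange L) (ψ₀ : L →ₐ[F₀] L) (ψ₁ : L →ₐ[F₁] L) (hψ : ∀ z, ψ₀ z = ψ₁ z)
    (P : (X.baseChange L).toAffine.Point) :
    Affine.Point.congrEquiv h (Affine.Point.map ψ₀ P) = Affine.Point.map ψ₁ (Affine.Point.congrEquiv h P) := by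
  rcases P with _ | ⟨x, y, hP⟩
  · rw [← Affine.Point.zero_def, map_zero, map_zero, map_zero]
  · rw [Affine.Point.map_some, Affine.Point.congrEquiv_some, Affine.Point.congrEquiv_some, Affine.Point.map_some]
    simp only [hψ]

end Congr

/-! ## §2. The twisting isomorphism on local points, with its sign rule -/

section Twist

variable {K : Type u} [Field K] (V₀ W₁ : WeierstrassCurve K) {d : K}
  (E : Type u) [Field E] [Algebra K E] [NeZero (2 : E)]

/-- **THE TWISTING ISOMORPHISM ON LOCAL POINTS.** For curves `V₀, W₁ / K` with `C • V₀^{(d)} = W₁` (`d ≠ 0`) and any `K`-field `E` with `2 ≠ 0`: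
an additive isomorphism `g : E₀(K̄_E) ≃+ E₁(K̄_E)` which commutes with every `σ ∈ Γ_E` fixing `√d ∈ K̄_E` and ANTI-commutes with every `σ`
negating `√d` (the twist cocycle). Local twin of `Additive.exists_addEquiv_geomPoints_of_model_twist_sign`, obtained from it over the base field
`E` (`(C • V₀^{(d)}) ⊗ E = C_E • (V₀ ⊗ E)^{(d)}`, `map_variableChange`, `map_quadraticTwist`) and the equivariant identification of §1.
[cite: SilvermanAEC2009, X.2 Prop. 2.4 and X.5 Cor. 5.4] -/
theorem exists_addEquiv_localPoints_of_model_twist_sign (hd : d ≠ 0) (hCW : ∃ C : VariableChange K, C • V₀.quadraticTwist d = W₁) :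
    ∃ g : localPoints V₀ E ≃+ localPoints W₁ E,
      (∀ σ : absoluteGaloisGroup E, σ • geomSqrt (algebraMap K E d) = geomSqrt (algebraMap K E d) →
        ∀ P, g (σ • P) = σ • g P) ∧
      (∀ σ : absoluteGaloisGroup E, σ • geomSqrt (algebraMap K E d) = -geomSqrt (algebraMap K E d) →
        ∀ P, g (σ • P) = -(σ • g P)) := by
  obtain ⟨C, hC⟩ := hCW
  have hdE : algebraMap K E d ≠ 0 := (map_ne_zero _).mpr hd
  have hCWE : ∃ C' : VariableChange E, C' • (V₀.baseChange E).quadraticTwist (algebraMap K E d) = W₁.baseChange E := by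
    refine ⟨VariableChange.baseChange C E, ?_⟩
    rw [← hC]
    simp only [WeierstrassCurve.baseChange, VariableChange.baseChange]
    rw [← map_variableChange, map_quadraticTwist]
  obtain ⟨g₀, hpos, hneg⟩ := exists_addEquiv_geomPoints_of_model_twist_sign (V₀.baseChange E) hdE hCWE
  set e₀ : geomPoints (V₀.baseChange E) ≃+ localPoints V₀ E :=
    Affine.Point.congrEquiv (baseChange_baseChange_algebraicClosure V₀ E) with he₀
  set e₁ : geomPoints (W₁.baseChange E) ≃+ localPoints W₁ E :=
    Affine.Point.congrEquiv (baseChange_baseChange_algebraicClosure W₁ E) with he₁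
  have he₀s : ∀ (σ : absoluteGaloisGroup E) (P : geomPoints (V₀.baseChange E)), e₀ (σ • P) = σ • e₀ P := fun σ P ↦ by
    rw [localPoints.smul_def]
    exact congrEquiv_map_comm (baseChange_baseChange_algebraicClosure V₀ E)
      ((show AlgebraicClosure E ≃ₐ[E] AlgebraicClosure E from σ) : AlgebraicClosure E →ₐ[E] AlgebraicClosure E) _ (fun _ ↦ rfl) P
  have he₁s : ∀ (σ : absoluteGaloisGroup E) (P : geomPoints (W₁.baseChange E)), e₁ (σ • P) = σ • e₁ P := fun σ P ↦ by
    rw [localPoints.smul_def]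
    exact congrEquiv_map_comm (baseChange_baseChange_algebraicClosure W₁ E)
      ((show AlgebraicClosure E ≃ₐ[E] AlgebraicClosure E from σ) : AlgebraicClosure E →ₐ[E] AlgebraicClosure E) _ (fun _ ↦ rfl) P
  have he₀s' : ∀ (σ : absoluteGaloisGroup E) Q, e₀.symm (σ • Q) = σ • e₀.symm Q := fun σ Q ↦ by
    apply e₀.injective
    rw [he₀s, e₀.apply_symm_apply, e₀.apply_symm_apply]
  refine ⟨(e₀.symm.trans g₀).trans e₁, fun σ hσ P ↦ ?_, fun σ hσ P ↦ ?_⟩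
  · simp only [AddEquiv.trans_apply]
    rw [he₀s', hpos σ hσ, he₁s]
  · simp only [AddEquiv.trans_apply]
    rw [he₀s', hneg σ hσ, map_neg, he₁s]

/-- **TRANSPORT OF A KUMMER-COMPATIBLE STABLE SUBGROUP ALONG THE TWIST.** If `𝒦 ≤ E₀(K̄_E)` is `Γ_E`-stable and contains `σP − P` for all `σ`
in a set `S` and all `P`, then `𝒦′ = g(𝒦) ≤ E₁(K̄_E)` is `Γ_E`-stable (the sign does not matter for a subgroup) and contains `σP − P` for every
`σ ∈ S` FIXING `√d` and every `P`; and `g` maps points outside `𝒦` outside `𝒦′`. [cite: GreenbergLNM1716, §2 pp. 70–75]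
[cite: SilvermanAEC2009, X.5 Cor. 5.4] -/
theorem exists_twistedKernel (hd : d ≠ 0) (hCW : ∃ C : VariableChange K, C • V₀.quadraticTwist d = W₁)
    (S : Set (absoluteGaloisGroup E)) (𝒦 : AddSubgroup (localPoints V₀ E))
    (hst : ∀ (σ : absoluteGaloisGroup E) (P : localPoints V₀ E), σ • P ∈ 𝒦 ↔ P ∈ 𝒦)
    (hkum : ∀ σ ∈ S, ∀ P : localPoints V₀ E, σ • P - P ∈ 𝒦) :
    ∃ (g : localPoints V₀ E ≃+ localPoints W₁ E) (𝒦' : AddSubgroup (localPoints W₁ E)),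
      (∀ (σ : absoluteGaloisGroup E) (P : localPoints W₁ E), σ • P ∈ 𝒦' ↔ P ∈ 𝒦') ∧
      (∀ σ ∈ S, σ • geomSqrt (algebraMap K E d) = geomSqrt (algebraMap K E d) → ∀ P : localPoints W₁ E, σ • P - P ∈ 𝒦') ∧
      (∀ P : localPoints V₀ E, g P ∈ 𝒦' ↔ P ∈ 𝒦) := by
  obtain ⟨g, hpos, hneg⟩ := exists_addEquiv_localPoints_of_model_twist_sign V₀ W₁ E hd hCW
  have hmem : ∀ P : localPoints V₀ E, g P ∈ 𝒦.map g.toAddMonoidHom ↔ P ∈ 𝒦 := fun P ↦ by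
    constructor
    · rintro ⟨Q, hQ, hQP⟩
      rwa [← g.injective hQP]
    · exact fun hP ↦ ⟨P, hP, rfl⟩
  refine ⟨g, 𝒦.map g.toAddMonoidHom, fun σ P ↦ ?_, fun σ _ hσ P ↦ ?_, hmem⟩
  · obtain ⟨Q, rfl⟩ := g.surjective P
    rcases map_geomSqrt (absoluteGaloisGroup.toAlgEquiv E σ) (algebraMap K E d) with h | h
    · rw [← hpos σ h, hmem, hmem, hst]
    · have h' : σ • g Q = -(g (σ • Q)) := by rw [hneg σ h, neg_neg]
      rw [h', neg_mem_iff, hmem, hmem, hst]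
  · obtain ⟨Q, rfl⟩ := g.surjective P
    rw [← hpos σ hσ, ← map_sub, hmem]
    exact hkum σ ‹σ ∈ S› Q

end Twist

/-! ## §3. On the frames: the twisted kernel of reduction of `cm7` at a place `w ∤ 7` -/

section Frame

variable {K : Type} [Field K] [NumberField K] {w : HeightOneSpectrum (𝓞 K)}
  {ν : Valuation (AlgebraicClosure (w.adicCompletion K)) ℝ≥0}
  (hν : ∀ x, (ν x : ℝ) = spectralNorm (w.adicCompletion K) (AlgebraicClosure (w.adicCompletion K)) x)

include hν in
/-- **THE TWISTED KERNEL OF REDUCTION AT A DYADIC PLACE OF AN S3c/S3b′ FRAME.** For `W/ℚ` with `C • W = cm7^{(d)}` (`d ≠ 0`), any number field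
`K` and any place `w` of `K` with `w ∤ 7`: there is a `Γ_{K_w}`-stable subgroup `𝒦′ ≤ W_K(K̄_w)` — the kernel of reduction of the good CM model
carried along the twisting isomorphism — such that **`σP − P ∈ 𝒦′` for every `σ` in the inertia group of `K_w` fixing `√d` and every
`P ∈ W_K(K̄_w)`** (Greenberg's Kummer compatibility for the twist: over `K_w(√d)` the curve has good reduction), and a point `T` with `2T = 0`,
`T ≠ 0`, `T ∉ 𝒦′` (the image of `(2, −1)`). [cite: GreenbergLNM1716, §2 Props. 2.2 and 2.4] [cite: SilvermanAEC2009, X.5 Cor. 5.4, VII.2.1] -/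
theorem exists_twistedReductionKernel_of_frame {d : ℤ} (hd0 : d ≠ 0) (W : WeierstrassCurve ℚ) (C : VariableChange ℚ)
    (hC : C • W = cm7.quadraticTwist (d : ℚ)) (hw7 : ((7 : ℤ) : 𝓞 K) ∉ w.asIdeal) :
    ∃ 𝒦' : AddSubgroup (localPoints (W.baseChange K) (w.adicCompletion K)),
      (∀ (σ : absoluteGaloisGroup (w.adicCompletion K)) (P : localPoints (W.baseChange K) (w.adicCompletion K)), σ • P ∈ 𝒦' ↔ P ∈ 𝒦') ∧
      (∀ σ ∈ absInertia (w.adicCompletion K),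
        σ • geomSqrt (algebraMap K (w.adicCompletion K) (d : K)) = geomSqrt (algebraMap K (w.adicCompletion K) (d : K)) →
        ∀ P : localPoints (W.baseChange K) (w.adicCompletion K), σ • P - P ∈ 𝒦') ∧
      (∃ T : localPoints (W.baseChange K) (w.adicCompletion K), 2 • T = 0 ∧ T ≠ 0 ∧ T ∉ 𝒦') := by
  haveI : CharZero (w.adicCompletion K) := charZero_of_injective_algebraMap (algebraMap K (w.adicCompletion K)).injective
  haveI : NeZero (2 : w.adicCompletion K) := ⟨by norm_num⟩
  have hd : ((d : ℚ) : K) ≠ 0 := by exact_mod_cast hd0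
  -- the twist relation over `K`
  have hCW : ∃ C' : VariableChange K, C' • (cm7.baseChange K).quadraticTwist ((d : ℚ) : K) = W.baseChange K := by
    refine ⟨(VariableChange.baseChange C K)⁻¹, ?_⟩
    rw [inv_smul_eq_iff]
    symm
    simp only [WeierstrassCurve.baseChange, VariableChange.baseChange]
    rw [map_variableChange, hC, map_quadraticTwist, map_intCast, Rat.cast_intCast]
  -- the kernel of reduction of `cm7 ⊗ K` at `w` and its transport
  obtain ⟨𝒦, hst, hkum, hint⟩ := exists_reductionKernel_cm7 (v := w) hν hw7
  obtain ⟨g, 𝒦', hst', hkum', hmem⟩ := exists_twistedKernel (cm7.baseChange K) (W.baseChange K) (w.adicCompletion K) hd hCW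
    (absInertia (w.adicCompletion K) : Set (absoluteGaloisGroup (w.adicCompletion K))) 𝒦 hst hkum
  have hdK : algebraMap K (w.adicCompletion K) (d : K) = algebraMap K (w.adicCompletion K) ((d : ℚ) : K) := by norm_cast
  refine ⟨𝒦', hst', fun σ hσ hfix P ↦ hkum' σ hσ (by rwa [← hdK]) P, ?_⟩
  -- the point `(2, −1)` of `cm7`
  have hΔ : ((cm7.baseChange K).baseChange (AlgebraicClosure (w.adicCompletion K))).Δ ≠ 0 := by
    rw [WeierstrassCurve.baseChange, WeierstrassCurve.map_Δ, WeierstrassCurve.baseChange, WeierstrassCurve.map_Δ, Δ_cm7]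
    simp only [map_neg, map_pow, map_ofNat, ne_eq, neg_eq_zero]
    norm_num
  have heq : ((cm7.baseChange K).baseChange (AlgebraicClosure (w.adicCompletion K))).toAffine.Equation 2 (-1) := by
    rw [WeierstrassCurve.Affine.equation_iff]
    simp [WeierstrassCurve.baseChange, WeierstrassCurve.map, map_ofNat]
    norm_num
  have hns : ((cm7.baseChange K).baseChange (AlgebraicClosure (w.adicCompletion K))).toAffine.Nonsingular 2 (-1) :=
    (WeierstrassCurve.Affine.equation_iff_nonsingular_of_Δ_ne_zero hΔ).mp heq
  have hneg : -(Affine.Point.some 2 (-1) hns :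
      ((cm7.baseChange K).baseChange (AlgebraicClosure (w.adicCompletion K))).toAffine.Point) = Affine.Point.some 2 (-1) hns := by
    rw [Affine.Point.neg_some]
    have hy : ((cm7.baseChange K).baseChange (AlgebraicClosure (w.adicCompletion K))).toAffine.negY 2 (-1) = -1 := by
      simp [WeierstrassCurve.Affine.negY, WeierstrassCurve.baseChange, WeierstrassCurve.map, map_ofNat]
      norm_num
    simp only [hy]
  have hT2pt : (2 : ℕ) • (Affine.Point.some 2 (-1) hns :
      ((cm7.baseChange K).baseChange (AlgebraicClosure (w.adicCompletion K))).toAffine.Point) = 0 := by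
    rw [two_nsmul, ← neg_eq_iff_add_eq_zero, hneg]
  set T₀ : localPoints (cm7.baseChange K) (w.adicCompletion K) := Affine.Point.some 2 (-1) hns with hT₀
  have hT₀2 : 2 • T₀ = 0 := hT2pt
  have hT₀0 : T₀ ≠ 0 := fun h ↦ by
    have h' : (Affine.Point.some 2 (-1) hns :
        ((cm7.baseChange K).baseChange (AlgebraicClosure (w.adicCompletion K))).toAffine.Point) = .zero := by
      rw [hT₀] at h
      exact h
    cases h'
  have h2le : ν (2 : AlgebraicClosure (w.adicCompletion K)) ≤ 1 := by
    have h2 : (2 : AlgebraicClosure (w.adicCompletion K)) =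
        algebraMap (w.adicCompletion K) (AlgebraicClosure (w.adicCompletion K)) 2 := by rw [map_ofNat]
    rw [h2, spectralValuation_algebraMap_le_one_iff hν]
    exact natCast_mem (w.adicCompletionIntegers K) 2
  have hT₀K : T₀ ∉ 𝒦 := hint 2 (-1) hns h2le
  refine ⟨g T₀, by rw [← map_nsmul, hT₀2, map_zero], fun h ↦ hT₀0 (g.injective (by rw [h, map_zero])), ?_⟩
  rw [hmem]
  exact hT₀K

end Frame

end Summit.BirchSwinnertonDyer.BirchSwinnertonDyer.Theorems.PrintCf2.ReductionKernel

end
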